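import Mathlib
import HarnessLib

/-!
# Venture HSemireg — family-S cells: ROUTE A = ROUTE B for the avoiding-transversal counts `A_r` (W5, N7-FEASIBILITY §3.1), for every `r`

Bookkeeping of the computation cell `pub-hsemireg`, group W5 (note `widen/W5/N7-FEASIBILITY-w5n7.md` §3.1 MODEL,
quoting t-23 FAMILY-S-N5 §4.1–4.2): for the uniform family-S model with `k` levels per coordinate, `m` tori per pair type and
`ζ + ζ̄ = s`, `ζ ζ̄ = m`, K-secancy prescribes the number of avoiding partial transversals
`A_r = k^r − m · Σ_{j=2}^{r} C(r,j) s_j k^{r−j}` (ROUTE A, with `s_2 = 1, s_3 = s, s_4 = s² − m, …`, i.e. `s_j = h_{j−1}` for the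
sequence `h_0 = 0, h_1 = 1, h_{n+2} = s h_{n+1} − m h_n`) `= Tr_{K/ℚ}(c · (k + ζ)^r)` with `c = ζ̄ ∕ (ζ̄ − ζ)` (ROUTE B).
The note records the agreement of the two routes as a MACHINE CHECK («Routes A = B on 273 716 (k,m,s) triples at n = 7 and
25 190 at n = 5, 0 mismatches»). This file proves it for EVERY `r` in any commutative ring (custodian seat w5-n6-1 gen 13,
2026-08-25; PLAIN, Mathlib only; no statement of the tree restated).

* `pow_eq_of_quadratic` — if `z² = s z − m` then `z^(j+1) = h_{j+1} z − m h_j` for the recurrence sequence `h`.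
* `add_pow_eq_routeA` — **ROUTE A as an identity**: `(k + z)^r = A_r + B_r · z` with
  `A_r = k^r − m Σ_{i<r} C(r,i+1) k^{r−1−i} h_i` (the `i = 0` term vanishes as `h_0 = 0`, so this is the printed sum over
  `j = i + 1 = 2 … r`) and `B_r = Σ_{i<r} C(r,i+1) k^{r−1−i} h_{i+1}`.
* `trace_routeB` — **ROUTE B**: over a field, with two roots `ζ ≠ ζ'` (`ζ + ζ' = s`, `ζ ζ' = m`) and `c = ζ' ∕ (ζ' − ζ)`,
  `c (P + Q ζ) + (1 − c)(P + Q ζ') = P`; `1 − c = ζ ∕ (ζ − ζ')` is the conjugate weight, so the left side is `Tr(c (P + Q ζ))`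
  written out, and with `add_pow_eq_routeA` this gives `Tr(c (k + ζ)^r) = A_r`.
* `routeA_four` — the printed `r = 4` instance `A_4 = k⁴ − m (6k² + 4sk + s² − m)` (N7F §3.1 ∕ SLIVER §0).

HONEST FRAMING: ring identities only (class arithmetic of ONE door's necessary conditions); nothing here says that HC, HC_CM
or HC_AV holds, and no door ∕ tier ∕ report sentence of the cell is a consequence of this file alone.
-/

namespace Summit.Ventures.HSemireg
namespace SecantCellRoutes
open Finset

variable {R : Type*} [CommRing R]

/-- Powers of a root of `z² = s z − m` in terms of the recurrence sequence `h` (`h_0 = 0`, `h_1 = 1`,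
`h_{n+2} = s h_{n+1} − m h_n`): `z^(j+1) = h_{j+1} z − m h_j`. -/
theorem pow_eq_of_quadratic (s m z : R) (h : ℕ → R) (h0 : h 0 = 0) (h1 : h 1 = 1)
    (hrec : ∀ n, h (n + 2) = s * h (n + 1) - m * h n) (hz : z ^ 2 = s * z - m) (j : ℕ) :
    z ^ (j + 1) = h (j + 1) * z - m * h j := by
  induction j with
  | zero => simp [h0, h1]
  | succ n ih =>
    have e : z ^ (n + 1 + 1) = z * z ^ (n + 1) := by ring
    rw [e, ih, hrec n]
    have : z * (h (n + 1) * z - m * h n) = h (n + 1) * z ^ 2 - m * h n * z := by ring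
    rw [this, hz]; ring

/-- **ROUTE A as an identity.** If `z² = s z − m` then for every `r`,
`(k + z)^r = (k^r − m Σ_{i<r} C(r,i+1) k^{r−1−i} h_i) + (Σ_{i<r} C(r,i+1) k^{r−1−i} h_{i+1}) · z`. -/
theorem add_pow_eq_routeA (s m z k : R) (h : ℕ → R) (h0 : h 0 = 0) (h1 : h 1 = 1)
    (hrec : ∀ n, h (n + 2) = s * h (n + 1) - m * h n) (hz : z ^ 2 = s * z - m) (r : ℕ) :
    (k + z) ^ r
      = ((k ^ r - m * ∑ i ∈ range r, (r.choose (i + 1) : R) * k ^ (r - 1 - i) * h i)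
        + (∑ i ∈ range r, (r.choose (i + 1) : R) * k ^ (r - 1 - i) * h (i + 1)) * z) := by
  have hp := pow_eq_of_quadratic s m z h h0 h1 hrec hz
  rw [add_comm k z, add_pow, Finset.sum_range_succ']
  simp only [pow_zero, one_mul, Nat.sub_zero, Nat.choose_zero_right, Nat.cast_one, mul_one]
  have e : ∀ i ∈ range r, z ^ (i + 1) * k ^ (r - (i + 1)) * (r.choose (i + 1) : R)
      = (r.choose (i + 1) : R) * k ^ (r - 1 - i) * h (i + 1) * z
        - m * ((r.choose (i + 1) : R) * k ^ (r - 1 - i) * h i) := by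
    intro i _
    have : r - (i + 1) = r - 1 - i := by omega
    rw [hp i, this]; ring
  rw [Finset.sum_congr rfl e, Finset.sum_sub_distrib, ← Finset.sum_mul, ← Finset.mul_sum]
  ring

/-- **ROUTE B** (the trace form). Over a field with `ζ ≠ ζ'`, the weight `c = ζ' ∕ (ζ' − ζ)` and its conjugate `1 − c`
extract the constant part: `c (P + Q ζ) + (1 − c)(P + Q ζ') = P`. With `add_pow_eq_routeA` (applied to `z = ζ`, a root
of `z² = (ζ + ζ') z − ζ ζ'`) this is `Tr(c (k + ζ)^r) = A_r`. -/
theorem trace_routeB {F : Type*} [Field F] (ζ ζ' P Q : F) (hne : ζ ≠ ζ') :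
    ζ' / (ζ' - ζ) * (P + Q * ζ) + (1 - ζ' / (ζ' - ζ)) * (P + Q * ζ') = P := by
  have hd : ζ' - ζ ≠ 0 := sub_ne_zero.mpr (Ne.symm hne)
  field_simp
  ring

/-- ROUTE B assembled: for roots `ζ ≠ ζ'` of `z² = s z − m` (`s = ζ + ζ'`, `m = ζ ζ'`) and `c = ζ' ∕ (ζ' − ζ)`,
`c (k + ζ)^r + (1 − c)(k + ζ')^r = A_r` (the left side is `Tr_{K∕ℚ}(c (k + ζ)^r)` when `ζ' = ζ̄`). -/
theorem routeB_eq_routeA {F : Type*} [Field F] (ζ ζ' k : F) (hne : ζ ≠ ζ') (h : ℕ → F) (h0 : h 0 = 0) (h1 : h 1 = 1)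
    (hrec : ∀ n, h (n + 2) = (ζ + ζ') * h (n + 1) - (ζ * ζ') * h n) (r : ℕ) :
    ζ' / (ζ' - ζ) * (k + ζ) ^ r + (1 - ζ' / (ζ' - ζ)) * (k + ζ') ^ r
      = k ^ r - (ζ * ζ') * ∑ i ∈ range r, (r.choose (i + 1) : F) * k ^ (r - 1 - i) * h i := by
  have hz : ζ ^ 2 = (ζ + ζ') * ζ - ζ * ζ' := by ring
  have hz' : ζ' ^ 2 = (ζ + ζ') * ζ' - ζ * ζ' := by ring
  rw [add_pow_eq_routeA (ζ + ζ') (ζ * ζ') ζ k h h0 h1 hrec hz r,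
    add_pow_eq_routeA (ζ + ζ') (ζ * ζ') ζ' k h h0 h1 hrec hz' r]
  exact trace_routeB ζ ζ' _ _ hne

/-- The printed instance `r = 4`: `A_4 = k⁴ − m (6 k² + 4 s k + s² − m)` (N7F §3.1; SLIVER-w5n62g18 §0's `A₄(t, m, s)`). -/
theorem routeA_four (s m k : R) (h : ℕ → R) (h0 : h 0 = 0) (h1 : h 1 = 1)
    (hrec : ∀ n, h (n + 2) = s * h (n + 1) - m * h n) :
    (k ^ 4 - m * ∑ i ∈ range 4, ((4 : ℕ).choose (i + 1) : R) * k ^ (4 - 1 - i) * h i)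
      = k ^ 4 - m * (6 * k ^ 2 + 4 * s * k + s ^ 2 - m) := by
  have h2 : h 2 = s := by rw [hrec 0, h1, h0]; ring
  have h3 : h 3 = s ^ 2 - m := by rw [show (3 : ℕ) = 1 + 2 from rfl, hrec 1, h2, h1]; ring
  simp only [Finset.sum_range_succ, Finset.sum_range_zero, h0, h1, h2, h3]
  norm_num [Nat.choose]
  ring

end SecantCellRoutes
end Summit.Ventures.HSemireg
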